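import Literature.MathematicalPhysics.QuantumFieldTheory.Balaban1983to89.B9Eq342GradientRowCubeLetters

/-!
# `Balaban1983to89.B9Eq326WeitzenbockHolonomyLetter` — T. Bałaban, *Propagators for lattice gauge theories in a background field*, Commun. Math. Phys. **99**
# (1985) 389–434 [Balaban1985BackgroundPropagators] (3.26) p. 395 (the local part `A₀`), (3.7) p. 391 (`Re U(∂p)`, `Im U(∂p)`), (3.5) p. 391, (3.1) p. 390,
# with [Balaban1985Variational] (135)–(136) p. 298 (the lattice Weitzenböck identity and «the bound on the curvature operator from the regularity condition»):
# **THE HOLONOMY LETTER `δ_𝒦` OF THE WEITZENBÖCK REMAINDER `𝒦` FROM THE PLAQUETTE SMALLNESS OF THE MODEL — for a unitary-type background (`U(b) ∈ U1`)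
# with `‖Re U(∂p) − 1‖ ≤ δ`, `‖Im U(∂p)‖ ≤ δ` on every plaquette and contracting transporters `R = Ad U`, `S = Ad U⁻¹`, the two transports around a plaquette
# corner differ by the conjugated plaquette variable: for `μ ≠ ν`, `w = x − e_ν`,
# `‖S(w,ν)R(w,μ)v − R(x,μ)S(w+e_μ,ν)v‖ ≤ 2M_φM_φ′·2δ·‖v‖`** — the `hHol` binder (`δ_𝒦 = 4M_φM_φ′δ`) of this lineage's (K47)
# `B9Eq326LocalPartZerothOrderWeightedRow` §2∕§4, (K56) `B9Eq326LocalPartZerothOrderCoshRow` §3 and (K57) `B9Eq326LocalPartDivergenceBlockLetterClosed`, DISCHARGED from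
# the model letters `hU hδ hRe hIm` (+ `hR hS`): `S(w,ν)R(w,μ) = Ad(P₁)`, `R(x,μ)S(w+e_μ,ν) = Ad(P₂)` with `P₁P₂⁻¹ = U(w,ν)⁻¹·U(∂p)·U(w,ν)`, `U(∂p)` the formal
# plaquette product at `w` in the directions `(μ, ν)` (`= plaqHolU` if `μ < ν`, its inverse if `ν < μ`), `‖U(∂p) − 1‖ ≤ ‖Re U(∂p) − 1‖ + ‖Im U(∂p)‖ ≤ 2δ`

statement-level skeleton of published theorems with citation tags; proofs where landed; nothing here is a claim about the Yang–Mills mass gap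

CITATION HEADER (lean-in-tree rule).  Audit cell `pub-balaban`, sub-cell `t4`, BINDER row NE9; filed by NE9 crux-team LEAF PROVER 05
(`b2b-balaban-t4-ne9-formalise-leaf-05`, gen 86).  Imports this lineage's (K50) `B9Eq342GradientRowCubeLetters` (for its import closure: `B9Eq384RemainderLetters.norm_adTransportW_sub_le`,
`B9Eq328GaugeAction.AdW_mul_apply`, `B9Eq310DeltaPrime.reHol_add_I_smul_imHol`, `B8CurlGradHolonomy.plaqHol` ∕ `norm_conj_le`, `B7Prop1Explicit.U1`).  SOURCE READ
first-hand in the held text layer [Balaban1985BackgroundPropagators] (`paper:balaban1985-cmp99-background-propagators`): p. 395 (3.26); p. 391 (3.5), (3.7);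
p. 390 (3.1); [Balaban1985Variational] p. 298 (135)–(136).  [folklore] group algebra BY NAME; nothing printed is a hypothesis; the `[cite: …]` tags are TEXT
LOCATIONS.

WHAT IS PROVED (sorry-free; 0 `def`; [folklore]).
* §1 **`plaqHol_mem_U1`**, **`norm_plaqHol_sub_one_le`** — the formal plaquette product `H_{μν}(w) = U(w,μ)U(w+e_μ,ν)U(w+e_ν,μ)⁻¹U(w,ν)⁻¹`
  (`B8CurlGradHolonomy.plaqHol`, any `μ ≠ ν`) lies in `U1` and `‖H_{μν}(w) − 1‖ ≤ 2δ` (`μ < ν`: `H = U(∂p) = Re + i·Im`; `ν < μ`: `H = U(∂p)⁻¹` and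
  `‖u⁻¹ − 1‖ ≤ ‖u − 1‖` on `U1`).
* §2 **`corner_eq_conj_plaqHol`** — `(U(w,ν)⁻¹U(w,μ))·(U(w+e_ν,μ)U(w+e_μ,ν)⁻¹)⁻¹ = U(w,ν)⁻¹·H_{μν}(w)·U(w,ν)` in `𝔸ˣ`; **`norm_corner_sub_one_le`** — its
  distance to `1` is `≤ 2δ`.
* §3 **`holonomy_letter`** — the `hHol` shape: for all `x`, `μ ≠ ν`, `v`: `‖S(x−e_ν,ν)(R(x−e_ν,μ)v) − R(x,μ)(S(x−e_ν+e_μ,ν)v)‖ ≤ (2M_φM_φ′(2δ))·‖v‖`.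
HONEST SCOPE.  Algebra and the model's plaquette letters only; `δ` is the model's letter (print: `‖U(∂p) − 1‖ = O(η²|F|)`, so `η⁻²δ_𝒦 = O(1)` at the top
level — the t-freeness of the `𝒦` term); nothing of [B9] Thm 3.1∕3.3∕3.11 is asserted, valued or discharged.  NOT NE9 (cell pub-balaban: NE9 NOT PRINTED ∕
NOT PROVED; «NE9 ⇐ the named binders»; row WALLED ON A MODEL (O-NE9-1; #5 UNRULED); spine PROVED 0∕9; rung (B)+1 on a finite T⁴ — NOT infinite volume, NOT
mass gap, NOT Clay; HONEST DEPENDENCY: continuum YM on T⁴ ⇐ BetaPertH ∧ nine spine estimates (0/9 proved); BetaPertH ⇐ (D1) ∧ (D4) ∧ CAP+tail; G-an2-4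
gates asym, D1 and NE2/3/4).  NEW file; nothing modified.  Net new unproved facts: 0.
-/

noncomputable section

set_option autoImplicit false

namespace Literature.MathematicalPhysics.QuantumFieldTheory.Balaban1983to89.B9Eq326WeitzenbockHolonomyLetter

open B4Sect5Torus (TSite)
open B9SectCLatticeCarrier (Bond DirPair shift unshift shift_unshift)
open B7Prop1Explicit (U1 mem_U1 norm_inv_sub_one_le)
open B9Eq310DeltaPrime (plaqHolU reHol imHol reHol_add_I_smul_imHol)
open B9Eq310HessianOperator (adTransportW)
open B9Eq328GaugeAction (AdW AdW_mul_apply adTransportW_eq_AdW)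
open B8CurlGradHolonomy (plaqHol norm_conj_le)
open B9Eq384RemainderLetters (norm_adTransportW_sub_le)

variable {d : ℕ} {Pd : Fin d → ℕ} {𝔸 : Type*} [NormedRing 𝔸] [NormedAlgebra ℂ 𝔸] [NormOneClass 𝔸]
  (U : Bond d Pd → 𝔸ˣ) (hU : ∀ b, U b ∈ U1 𝔸) {δ : ℝ}
  (hRe : ∀ p : B9SectCLatticeCarrier.Plaq d Pd, ‖reHol U p - 1‖ ≤ δ) (hIm : ∀ p : B9SectCLatticeCarrier.Plaq d Pd, ‖imHol U p‖ ≤ δ)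

/-! ## §1 The formal plaquette product in either orientation: in `U1`, within `2δ` of `1` -/

omit [NormedAlgebra ℂ 𝔸] in
include hU in
/-- `H_{μν}(w) ∈ U1` (a product of four `U1` elements). [folklore] [cite: Balaban1985BackgroundPropagators, (3.5) p.391] -/
theorem plaqHol_mem_U1 (w : TSite d Pd) (μ ν : Fin d) :
    plaqHol (shift μ) (shift ν) (fun y => U (y, μ)) (fun y => U (y, ν)) w ∈ U1 𝔸 := by
  unfold plaqHol
  exact Subgroup.mul_mem _ (Subgroup.mul_mem _ (Subgroup.mul_mem _ (hU _) (hU _)) (Subgroup.inv_mem _ (hU _))) (Subgroup.inv_mem _ (hU _))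

omit [NormOneClass 𝔸] in
include hRe hIm in
/-- **`‖U(∂p) − 1‖ ≤ 2δ`** for a plaquette of the carrier (`U(∂p) = Re U(∂p) + i·Im U(∂p)`). [folklore] [cite: Balaban1985BackgroundPropagators, (3.7) p.391] -/
theorem norm_plaqHolU_sub_one_le (p : B9SectCLatticeCarrier.Plaq d Pd) : ‖(plaqHolU U p : 𝔸) - 1‖ ≤ 2 * δ := by
  have e : (plaqHolU U p : 𝔸) - 1 = (reHol U p - 1) + Complex.I • imHol U p := by
    rw [← reHol_add_I_smul_imHol U p]; abel
  rw [e]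
  calc ‖reHol U p - 1 + Complex.I • imHol U p‖ ≤ ‖reHol U p - 1‖ + ‖Complex.I • imHol U p‖ := norm_add_le _ _
    _ ≤ δ + δ := by
        refine add_le_add (hRe p) ?_
        rw [norm_smul, Complex.norm_I, one_mul]; exact hIm p
    _ = 2 * δ := by ring

include hU hRe hIm in
/-- **`‖H_{μν}(w) − 1‖ ≤ 2δ` IN EITHER ORIENTATION** (`μ < ν`: `H = U(∂p_{μν}(w))`; `ν < μ`: `H = U(∂p_{νμ}(w))⁻¹`). [folklore]
[cite: Balaban1985BackgroundPropagators, (3.1) p.390, (3.5) p.391, (3.7) p.391] -/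
theorem norm_plaqHol_sub_one_le (w : TSite d Pd) {μ ν : Fin d} (hne : μ ≠ ν) :
    ‖((plaqHol (shift μ) (shift ν) (fun y => U (y, μ)) (fun y => U (y, ν)) w : 𝔸ˣ) : 𝔸) - 1‖ ≤ 2 * δ := by
  rcases lt_or_gt_of_ne hne with h | h
  · -- positively oriented: literally `plaqHolU` at the plaquette `(w, (μ, ν))`
    exact norm_plaqHolU_sub_one_le U hRe hIm (w, ⟨(μ, ν), h⟩)
  · -- negatively oriented: the inverse of `plaqHolU` at `(w, (ν, μ))`
    have e : plaqHol (shift μ) (shift ν) (fun y => U (y, μ)) (fun y => U (y, ν)) w = (plaqHolU U (w, ⟨(ν, μ), h⟩))⁻¹ := by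
      simp only [plaqHol, plaqHolU, mul_inv_rev, inv_inv, mul_assoc]
    rw [e]
    have hmem : plaqHolU U (w, ⟨(ν, μ), h⟩) ∈ U1 𝔸 := plaqHol_mem_U1 U hU w ν μ
    exact (norm_inv_sub_one_le hmem).trans (norm_plaqHolU_sub_one_le U hRe hIm (w, ⟨(ν, μ), h⟩))

/-! ## §2 The corner: `P₁P₂⁻¹` is the plaquette product conjugated by `U(w,ν)` -/

omit [NormedAlgebra ℂ 𝔸] [NormOneClass 𝔸] in
/-- **THE CORNER IDENTITY** in `𝔸ˣ`: `P₁ = U(w,ν)⁻¹U(w,μ)`, `P₂ = U(w+e_ν,μ)U(w+e_μ,ν)⁻¹` ⟹ `P₁P₂⁻¹ = U(w,ν)⁻¹·H_{μν}(w)·U(w,ν)`. [folklore]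
[cite: Balaban1985BackgroundPropagators, (3.1) p.390, (3.5) p.391] -/
theorem corner_eq_conj_plaqHol (w : TSite d Pd) (μ ν : Fin d) :
    ((U (w, ν))⁻¹ * U (w, μ)) * (U (shift ν w, μ) * (U (shift μ w, ν))⁻¹)⁻¹ =
      (U (w, ν))⁻¹ * plaqHol (shift μ) (shift ν) (fun y => U (y, μ)) (fun y => U (y, ν)) w * U (w, ν) := by
  simp only [plaqHol, mul_inv_rev, inv_inv, mul_assoc, inv_mul_cancel, mul_one]

include hU hRe hIm in
/-- **`‖P₁P₂⁻¹ − 1‖ ≤ 2δ`** (conjugation by a `U1` element does not increase the distance to `1`). [folklore]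
[cite: Balaban1985BackgroundPropagators, (3.5) p.391, (3.7) p.391] -/
theorem norm_corner_sub_one_le (w : TSite d Pd) {μ ν : Fin d} (hne : μ ≠ ν) :
    ‖((((U (w, ν))⁻¹ * U (w, μ)) * (U (shift ν w, μ) * (U (shift μ w, ν))⁻¹)⁻¹ : 𝔸ˣ) : 𝔸) - 1‖ ≤ 2 * δ := by
  rw [corner_eq_conj_plaqHol]
  set H : 𝔸ˣ := plaqHol (shift μ) (shift ν) (fun y => U (y, μ)) (fun y => U (y, ν)) w with hH
  have e : ((((U (w, ν))⁻¹ * H * U (w, ν) : 𝔸ˣ)) : 𝔸) - 1 = (((U (w, ν))⁻¹ : 𝔸ˣ) : 𝔸) * ((H : 𝔸) - 1) * ((((U (w, ν))⁻¹)⁻¹ : 𝔸ˣ) : 𝔸) := by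
    rw [inv_inv, Units.val_mul, Units.val_mul, mul_sub, sub_mul, mul_one, Units.inv_mul]
  rw [e]
  have h1 := (mem_U1.1 (hU (w, ν)))
  refine (norm_conj_le ((U (w, ν))⁻¹) ((H : 𝔸) - 1) h1.2 (by rw [inv_inv]; exact h1.1)).trans ?_
  exact norm_plaqHol_sub_one_le U hU hRe hIm w hne

/-! ## §3 The holonomy letter of `𝒦` for the transporters `Ad U`, `Ad U⁻¹` -/

variable {W : Type*} [NormedAddCommGroup W] [InnerProductSpace ℂ W] (φ : W ≃ₗ[ℂ] 𝔸) {Mφ Mφ' : ℝ}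
  (hφ : ∀ w, ‖φ w‖ ≤ Mφ * ‖w‖) (hφ' : ∀ X, ‖φ.symm X‖ ≤ Mφ' * ‖X‖) (hMφ : 0 ≤ Mφ) (hMφ' : 0 ≤ Mφ')
  (hR : ∀ (b : Bond d Pd) (w : W), ‖adTransportW φ U b w‖ ≤ ‖w‖)
  (hS : ∀ (b : Bond d Pd) (w : W), ‖adTransportW φ (fun bb => (U bb)⁻¹) b w‖ ≤ ‖w‖)

include hU hRe hIm hφ hφ' hMφ hMφ' hR hS in
/-- **THE HOLONOMY LETTER `δ_𝒦 = 2M_φM_φ′·(2δ)`** (the `hHol` binder of `B9Eq326LocalPartZerothOrderWeightedRow` §2∕§4 for `R = Ad U`, `S = Ad U⁻¹`): for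
`μ ≠ ν` and every `v`, `‖S(x−e_ν,ν)(R(x−e_ν,μ)v) − R(x,μ)(S(x−e_ν+e_μ,ν)v)‖ ≤ 2M_φM_φ′(2δ)·‖v‖` — `S(w,ν)R(w,μ) = Ad(P₁) = Ad(P₁P₂⁻¹)∘Ad(P₂)`,
`R(x,μ)S(w+e_μ,ν) = Ad(P₂)` (`x = w + e_ν`), `‖Ad(Q)u − u‖ ≤ 2M_φM_φ′‖Q − 1‖‖u‖` (`B9Eq384RemainderLetters.norm_adTransportW_sub_le`) with §2, and `‖Ad(P₂)v‖ ≤ ‖v‖`.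
[folklore] [cite: Balaban1985BackgroundPropagators, (3.26) p.395, (3.5) p.391, (3.7) p.391; Balaban1985Variational, (135)–(136) p.298] -/
theorem holonomy_letter (x : TSite d Pd) (μ ν : Fin d) (hne : μ ≠ ν) (v : W) :
    ‖adTransportW φ (fun bb => (U bb)⁻¹) (unshift ν x, ν) (adTransportW φ U (unshift ν x, μ) v) -
        adTransportW φ U (x, μ) (adTransportW φ (fun bb => (U bb)⁻¹) (shift μ (unshift ν x), ν) v)‖ ≤
      2 * Mφ * Mφ' * (2 * δ) * ‖v‖ := by
  set w := unshift ν x with hw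
  have hx : x = shift ν w := by rw [hw, shift_unshift]
  -- the two corner transports as `Ad` of group elements
  set P₁ : 𝔸ˣ := (U (w, ν))⁻¹ * U (w, μ) with hP₁
  set P₂ : 𝔸ˣ := U (shift ν w, μ) * (U (shift μ w, ν))⁻¹ with hP₂
  have h1 : adTransportW φ (fun bb => (U bb)⁻¹) (w, ν) (adTransportW φ U (w, μ) v) = AdW φ P₁ v := by
    rw [adTransportW_eq_AdW, adTransportW_eq_AdW, ← AdW_mul_apply]
  have h2 : adTransportW φ U (x, μ) (adTransportW φ (fun bb => (U bb)⁻¹) (shift μ w, ν) v) = AdW φ P₂ v := by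
    rw [adTransportW_eq_AdW, adTransportW_eq_AdW, ← AdW_mul_apply, hx]
  have hu : ‖AdW φ P₂ v‖ ≤ ‖v‖ := by
    rw [← h2]; exact (hR _ _).trans (hS _ _)
  -- `Ad(P₁)v − Ad(P₂)v = Ad(Q)(Ad(P₂)v) − Ad(P₂)v`, `Q = P₁P₂⁻¹`
  have h3 : AdW φ P₁ v = AdW φ (P₁ * P₂⁻¹) (AdW φ P₂ v) := by
    rw [← AdW_mul_apply, inv_mul_cancel_right]
  have hQ1 : P₁ * P₂⁻¹ ∈ U1 𝔸 :=
    Subgroup.mul_mem _ (Subgroup.mul_mem _ (Subgroup.inv_mem _ (hU _)) (hU _))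
      (Subgroup.inv_mem _ (Subgroup.mul_mem _ (hU _) (Subgroup.inv_mem _ (hU _))))
  have hQ : ‖((P₁ * P₂⁻¹ : 𝔸ˣ) : 𝔸) - 1‖ ≤ 2 * δ := norm_corner_sub_one_le U hU hRe hIm w hne
  have h4 := norm_adTransportW_sub_le φ hφ hφ' hMφ' (fun _ : Bond d Pd => P₁ * P₂⁻¹) (w, ν) hQ1 hQ (AdW φ P₂ v)
  rw [adTransportW_eq_AdW] at h4
  rw [h1, h2, h3]
  refine h4.trans ?_
  have hM : 0 ≤ 2 * Mφ * Mφ' * (2 * δ) := by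
    have hδ2 : 0 ≤ 2 * δ := (norm_nonneg _).trans hQ
    have hδ : 0 ≤ δ := by linarith
    positivity
  exact mul_le_mul_of_nonneg_left hu hM

end Literature.MathematicalPhysics.QuantumFieldTheory.Balaban1983to89.B9Eq326WeitzenbockHolonomyLetter

end
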